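import Mathlib
import Summits.PneNP.PneNP.Theses.OverlapGapAlgebra
import Summits.PneNP.PneNP.Theorems.OverlapGapAlgebraNoStableSection
import Summits.PneNP.PneNP.Theorems.OverlapGapAlgebraSearchHardWindowWeakClassRung
import Summits.PneNP.PneNP.Theorems.OverlapGapAlgebraSearchHardWindowTruncationSurrogate
import Summits.PneNP.PneNP.Theorems.OverlapGapAlgebraSearchHardWindowACTailBound
import Summits.PneNP.PneNP.Theorems.OverlapGapAlgebraSearchHardWindowRungs
import Literature.Computability.Complexity.DecisionTree
import Literature.Computability.Complexity.ConstantDepth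
import Literature.Computability.Complexity.ACFourierTails
import Literature.Computability.Complexity.RandomKSatLowDegreeHardness

/-!
# Route OverlapGapAlgebra, crux `SearchHardWindow` (stmt-PneNP-2460), line `Sketch`: the weak
# rungs, UNCONDITIONAL

Registered stub `stub_weakRungsUnconditional` of the skeleton
`Summits/PneNP/PneNP/Cruxes/SearchHardWindow/Lines/Sketch.lean` (Line A, v8). The weak class rung
`stub_weakClassRung` (`…SearchHardWindowWeakClassRung.lean`) is conditional only on the route's
probability crux `NoStableSection`, which is now a tree THEOREM (`noStableSection_proof`,
`…NoStableSection.lean`, crux stmt-PneNP-2462), and on the truncation surrogate, which is the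
landed `stub_truncationSurrogate`. This file instantiates it, with no hypothesis and no named fact,
for the two solver classes of the card:

* **polynomial-size `AC⁰`** — for `k ≥ k₀` there is `c > 0` such that for every depth `d` and size
  exponent `e`, eventually in `n`, whenever `n = 2^j` and `m = ⌊5 · 2^k log k / k · n⌋`, every
  family of `acBasis` circuits of `acDepth ≤ d` and size `≤ n^e` (one circuit per output variable,
  reading the `m·k·(j+1)` bits of a literal array under `litArrayOfBits`) outputs a satisfying
  assignment of the decoded instance for at most `(1 − c/log(2n)) · 2^{m k (j+1)}` inputs. The
  class is fed to `stub_weakClassRung` at Tal's explicit level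
  `D n = B^{d+2} ⌊log₂(2n^e+1)⌋^d (3(⌊log₂ n⌋ + 1) + 3(d + 2)) + 1` of `…ACTailBound.lean`
  (`shwACTail_tailWeight_le`: tails `≤ n⁻³` for all `n ≥ 1`), which is `O((log n)^{d+1})`, hence
  `o(n / log n)` (`wru_acLevel_isLittleO`, from `(log n)^{d+2} = o(n)`,
  `Real.isLittleO_pow_log_id_atTop`).
* **bounded-query algorithms (decision trees)** — for `k ≥ k₀` there is `c > 0` such that for
  every query budget `t(n) = o(n / log n)`, eventually in `n`, every family of Boolean decision
  trees of depth `≤ t(n)` over the instance bits succeeds on at most `(1 − c/log(2n)) · 2^{m k (j+1)}`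
  inputs: the class rung at level `D n = t n + 1` (still `o(n / log n)`), above which decision
  trees of depth `≤ t n` have no Fourier weight (`tailWeight_decisionTree_eq_zero`).

In both cases the constant `c` (and `k₀`) is the one of `stub_weakClassRung`, depending on `k` only.
Adapted from `stub_acZeroRung` / `stub_decisionTreeRung` (`…SearchHardWindowRungs.lean`) and
`shwACTail_level_isLittleO` (`…ACTailBound.lean`). No definitions are introduced.

References: G. Bresler, B. Huang, FOCS 2021 / arXiv:2106.02129, Thm. 2.6 [BreslerHuang2022];
A. Tal, CCC 2017, Thm. 3.6 [Tal2017].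

Prover prover-line-stmt-PneNP-2460-c1-0 (stub worker), 2026-08-16.
-/

-- `Summit.PneNP.PneNP.…` is the tree's mandated namespace (summit = sub-problem name).
set_option linter.dupNamespace false

namespace Summit.PneNP.PneNP.Theorems

open Finset Filter Asymptotics
open Literature.Computability.Complexity
open Literature.Computability.Complexity.LowDegree
open Literature.Probability.RandomGraphs.LowDegree (sgn walsh)
open Summit.PneNP.PneNP.Theses.OverlapGapAlgebra
open scoped Classical

/-! ### Polylogarithmic levels are `o(n / log n)` -/

/-- `(log n)^p = o(n / log n)` along the naturals: `(log x)^{p+1} = o(x)`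
(`Real.isLittleO_pow_log_id_atTop`) divided by `log x`, which is eventually nonzero. [folklore] -/
theorem wru_pow_log_isLittleO_div_log (p : ℕ) :
    (fun n : ℕ => Real.log (n : ℝ) ^ p) =o[atTop] (fun n : ℕ => (n : ℝ) / Real.log n) := by
  have hR : (fun x : ℝ => Real.log x ^ p) =o[atTop] (fun x : ℝ => x / Real.log x) := by
    have h1 : (fun x : ℝ => Real.log x ^ (p + 1)) =o[atTop] id := Real.isLittleO_pow_log_id_atTop
    have h3 := h1.mul_isBigO (isBigO_refl (fun x : ℝ => (Real.log x)⁻¹) atTop)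
    refine h3.congr' ?_ (Eventually.of_forall fun x => by simp [div_eq_mul_inv])
    filter_upwards [eventually_gt_atTop 1] with x hx
    rw [pow_succ, mul_inv_cancel_right₀ (Real.log_pos hx).ne']
  exact hR.comp_tendsto tendsto_natCast_atTop_atTop

/-- Tal's level `D n = B^{d+2} ⌊log₂(2n^c+1)⌋^d (3(⌊log₂ n⌋ + 1) + 3(d + 2)) + 1` of
`…SearchHardWindowACTailBound.lean` is `O((log n)^{d+1})` (`shwACTail_logM_le`, `shwACTail_exp_le`,
and `1 ≤ (log n)^{d+1}` eventually), hence `o(n / log n)`. Adapted from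
`shwACTail_level_isLittleO`. [folklore] -/
theorem wru_acLevel_isLittleO (d c : ℕ) :
    (fun n : ℕ => ((ACForm.cB ^ (d + 2) * ACForm.logM (2 * n ^ c) ^ d *
        (3 * (Nat.log 2 n + 1) + 3 * (d + 2)) + 1 : ℕ) : ℝ)) =o[atTop]
      (fun n : ℕ => (n : ℝ) / Real.log n) := by
  set K : ℝ := (ACForm.cB : ℝ) ^ (d + 2) * ((c + 2 : ℝ) / Real.log 2) ^ d *
    ((3 * d + 12 : ℝ) / Real.log 2) with hK
  have hlog : ∀ᶠ n : ℕ in atTop, 1 ≤ Real.log (n : ℝ) :=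
    (Real.tendsto_log_atTop.comp tendsto_natCast_atTop_atTop).eventually_ge_atTop 1
  have h2 : (fun n : ℕ => ((ACForm.cB ^ (d + 2) * ACForm.logM (2 * n ^ c) ^ d *
      (3 * (Nat.log 2 n + 1) + 3 * (d + 2)) + 1 : ℕ) : ℝ)) =O[atTop]
      (fun n : ℕ => Real.log (n : ℝ) ^ (d + 1)) := by
    refine IsBigO.of_bound (K + 1) ?_
    filter_upwards [eventually_ge_atTop 2, hlog] with n hn hlogn
    have hℓ := shwACTail_logM_le c hn
    have hE := shwACTail_exp_le d hn
    have hlogn0 : 0 ≤ Real.log (n : ℝ) := Real.log_natCast_nonneg n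
    have hpow1 : 1 ≤ Real.log (n : ℝ) ^ (d + 1) := one_le_pow₀ hlogn
    rw [Real.norm_natCast, Real.norm_of_nonneg (pow_nonneg hlogn0 _)]
    push_cast at hE ⊢
    calc (ACForm.cB : ℝ) ^ (d + 2) * ((ACForm.logM (2 * n ^ c) : ℕ) : ℝ) ^ d *
          (3 * ((Nat.log 2 n : ℝ) + 1) + 3 * ((d : ℝ) + 2)) + 1
        ≤ (ACForm.cB : ℝ) ^ (d + 2) * ((c + 2 : ℝ) / Real.log 2 * Real.log n) ^ d *
            ((3 * d + 12 : ℝ) / Real.log 2 * Real.log n) + Real.log (n : ℝ) ^ (d + 1) := by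
          gcongr
      _ = (K + 1) * Real.log n ^ (d + 1) := by
          rw [hK, mul_pow ((c + 2 : ℝ) / Real.log 2) (Real.log n) d]; ring
  exact h2.trans_isLittleO (wru_pow_log_isLittleO_div_log (d + 1))

/-! ### The two unconditional weak rungs -/

/-- **Unconditional weak rungs (registered stub `stub_weakRungsUnconditional` of crux
stmt-PneNP-2460, Line A, skeleton v8).** (1) There is `k₀` such that for every `k ≥ k₀` there is
`c > 0` with: for all depths `d` and size exponents `e`, eventually in `n`, whenever `n = 2^j` and
`m = ⌊5 · 2^k log k / k · n⌋`, every family of `acBasis` circuits of `acDepth ≤ d` and size `≤ n^e`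
(one per output variable, reading the `m·k·(j+1)` instance bits) outputs a satisfying assignment of
the decoded literal array for at most `(1 − c/log(2n)) · 2^{m k (j+1)}` inputs. (2) The same for
families of Boolean decision trees of depth `≤ t(n)` for any query budget `t(n) = o(n / log n)`.
Both are `stub_weakClassRung` fed with the tree theorem `noStableSection_proof` and the landed
surrogate `stub_truncationSurrogate`; the `AC⁰` class enters at Tal's explicit polylogarithmic level
(`shwACTail_tailWeight_le`, level `o(n / log n)` by `wru_acLevel_isLittleO`), the decision-tree
class at level `t n + 1`, above which its Fourier weight vanishes
(`tailWeight_decisionTree_eq_zero`). No named fact, no hypothesis. Adapted from `stub_acZeroRung` and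
`stub_decisionTreeRung`. [BreslerHuang2022, Thm. 2.6; Tal2017, Thm. 3.6] -/
theorem stub_weakRungsUnconditional :
    (∃ k₀ : ℕ, ∀ k : ℕ, k₀ ≤ k → ∃ c : ℝ, 0 < c ∧ ∀ d e : ℕ, ∀ᶠ n : ℕ in atTop, ∀ j m : ℕ,
      n = 2 ^ j → m = ⌊5 * 2 ^ k * Real.log k / k * n⌋₊ →
      ∀ C : Fin (2 ^ j) → Circuit (Fin (m * k * (j + 1))),
        (∀ v, (C v).IsOver acBasis ∧ (C v).acDepth ≤ d ∧ (C v).size ≤ n ^ e) →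
        ((univ.filter fun x : Fin (m * k * (j + 1)) → Bool => ∀ i : Fin m, ∃ j' : Fin k,
            (C (litArrayOfBits m k j x i j').1).eval x = (litArrayOfBits m k j x i j').2).card : ℝ)
          ≤ (1 - c / Real.log (2 * n)) * 2 ^ (m * k * (j + 1))) ∧
    (∃ k₀ : ℕ, ∀ k : ℕ, k₀ ≤ k → ∃ c : ℝ, 0 < c ∧ ∀ t : ℕ → ℕ,
      (fun n : ℕ => (t n : ℝ)) =o[atTop] (fun n : ℕ => (n : ℝ) / Real.log n) →
      ∀ᶠ n : ℕ in atTop, ∀ j m : ℕ, n = 2 ^ j → m = ⌊5 * 2 ^ k * Real.log k / k * n⌋₊ →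
      ∀ T : Fin (2 ^ j) → DecisionTree (m * k * (j + 1)), (∀ v, (T v).depth ≤ t n) →
        ((univ.filter fun x : Fin (m * k * (j + 1)) → Bool => ∀ i : Fin m, ∃ j' : Fin k,
            (T (litArrayOfBits m k j x i j').1).eval x = (litArrayOfBits m k j x i j').2).card : ℝ)
          ≤ (1 - c / Real.log (2 * n)) * 2 ^ (m * k * (j + 1))) := by
  obtain ⟨k₀, hcls⟩ := stub_weakClassRung noStableSection_proof
    (fun D hD g τ hτ => stub_truncationSurrogate D hD g τ hτ)
  refine ⟨⟨k₀, fun k hk => ?_⟩, ⟨k₀, fun k hk => ?_⟩⟩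
  · -- (1) polynomial-size `AC⁰`, at Tal's explicit level
    obtain ⟨c, hc, h⟩ := hcls k hk
    refine ⟨c, hc, fun d e => ?_⟩
    have h' := h (fun n N g => ∃ C : Circuit (Fin N), C.IsOver acBasis ∧ C.acDepth ≤ d ∧
        C.size ≤ n ^ e ∧ ∀ x, g x = C.eval x)
      (fun n => ACForm.cB ^ (d + 2) * ACForm.logM (2 * n ^ e) ^ d *
        (3 * (Nat.log 2 n + 1) + 3 * (d + 2)) + 1)
      (wru_acLevel_isLittleO d e) (fun n => Nat.le_add_left 1 _)
      (eventually_atTop.2 ⟨1, fun n hn N g hg => by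
        obtain ⟨C, hC, hd, hs, hg⟩ := hg
        obtain rfl : g = fun x => C.eval x := funext hg
        exact shwACTail_tailWeight_le d e hn N C hC hd hs⟩)
    filter_upwards [h'] with n hn j m hnj hm C hC
    exact hn j m hnj hm (fun v => (C v).eval) fun v =>
      ⟨C v, (hC v).1, (hC v).2.1, (hC v).2.2, fun _ => rfl⟩
  · -- (2) decision trees of depth `≤ t n`, at level `t n + 1`
    obtain ⟨c, hc, h⟩ := hcls k hk
    refine ⟨c, hc, fun t ht => ?_⟩
    have hDo : (fun n : ℕ => ((t n + 1 : ℕ) : ℝ)) =o[atTop] (fun n : ℕ => (n : ℝ) / Real.log n) := by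
      have h1 : (fun _ : ℕ => (1 : ℝ)) =o[atTop] (fun n : ℕ => (n : ℝ) / Real.log n) := by
        simpa using wru_pow_log_isLittleO_div_log 0
      simpa [Nat.cast_add, Nat.cast_one] using ht.add h1
    have h' := h (fun n N g => ∃ T : DecisionTree N, T.depth ≤ t n ∧ ∀ x, g x = T.eval x)
      (fun n => t n + 1) hDo (fun n => Nat.succ_le_succ (Nat.zero_le _))
      (Eventually.of_forall fun n N g hg => by
        obtain ⟨T, hT, hg⟩ := hg
        rw [tailWeight_decisionTree_eq_zero sgn T (fun x => by rw [hg x]) (Nat.lt_succ_of_le hT)]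
        positivity)
    filter_upwards [h'] with n hn j m hnj hm T hT
    exact hn j m hnj hm (fun v => (T v).eval) fun v => ⟨T v, hT v, fun _ => rfl⟩

end Summit.PneNP.PneNP.Theorems
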